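import Literature.AlgebraicGeometry.Motives.HodgeThetaSubalgebraUnitaryNineTenCore
import Literature.AlgebraicGeometry.Motives.HodgeThetaSubalgebraUnitaryFiveCoreAll
import HarnessLib

/-!
# The `Θ`-subalgebra theorem for unitary multiplicities `(15, 16)` — reduction of the last `p = 31` cell to a maximal
# raising rank `10` or `12` (Ribet 1983 Thm. 3, Lie step; abelian 31-folds of type `(15, 16)`)

Family `hodge`, layer `Literature/AlgebraicGeometry/Motives` (pure linear algebra over `ℂ`; no geometry). Research
context: cell `pub-hodge-ring2` (HONEST FRAMING: research route conditional on HC_CM; not a corollary; Q11.4-sentence-2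
already refuted in dim ≥ 3), Literature lane gen 87, programme R75. UNCONDITIONAL; theorems only, no definition, no
named fact (D-0026), no `sorry`. HONEST SCOPE: this file does NOT prove the `(15 | 16)` core; it proves that a proper
irreducible unitary `Θ`-subalgebra of type `(15 | 16)` has maximal raising rank `10` or `12` (and no raising operator
of odd rank or of rank `2`).

THE PRINT. K. A. Ribet, Amer. J. Math. 105 (1983), Thm. 3 = Gordon's survey Thm. 6.3 (3) [held
`paper:arxiv-alg-geom_9709030` p. 18]: `End⁰ = k` imaginary quadratic acting with coprime multiplicities `(n′, n″)` ⟹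
`Hg = U(V, φ)`, `B•(Xⁿ) = D•(Xⁿ)`. The lane replaces Ribet's appeal to the classification of minuscule representations
pair by pair; after `(9, 10)` (`HodgeThetaSubalgebraUnitaryNineTenCore`) and `(12, 19)`
(`HodgeThetaSubalgebraUnitaryTwelveNineteenCore`) the pair `(15, 16)` is the only open pair with `n′ + n″ ≤ 31` prime.

THE SETTING is that of the tree's unitary cores: `𝔊 ⊆ End_ℂ(W)` bracket-closed and irreducible, an involution
`Θ ∈ 𝔊` with eigenspaces `P`, `Q` (`dim P = 15`, `dim Q = 16`), a Hermitian pairing `s` with `P ⊥ Q`, definite on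
`P` and on `Q`, for which `𝔊` is adjoint-closed. For a raising `B` of rank `r` the Levi pair
(`UnitaryLeviSetup.exists_levi_pair`) consists of the concrete Levi algebras `L⁺` on `U⁺` (type `(15 − r | r)`) and
`L⁻` on `U⁻` (type `(r | 16 − r)`); a raising `X` commuting with the involution `ι` of `B` has profile
`(i, j) = (rk X|_{U⁺}, rk X|_{U⁻})`, `rk X = i + j`.

* §0 The maximality polarisation packaged: if `B` has maximal rank, `dim(P ∩ U⁺) ≥ 2`, `Q ∩ U⁺ ≠ 0` and `L⁺` is
  full, then `𝔊` has a rank-one raising operator (`UnitaryLeviFull.exists_rankOne_raise_of_maxRank`).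
* §1 If `𝔊 ≠ End(W)` every odd rank is absent (the larger-side Levi types `(1|15)`, `(3|13)`, `(5|11)`, `(7|9)`,
  `(9|7)`, `(11|5)`, `(13|3)`, `(15|1)` are tree cores), so `S ⊆ {0, 2, …, 14}`; (G1) `no_rank_two`: `L⁺` of type
  `(13|2)` is full (`UnitaryTwoOdd.eq_top'`); a rank-one lift has profile `(1, 1)`, so `L⁻` of type `(2|14)` is full
  (`UnitaryRankOneRaise.eq_top_of_rankOne_raise_two`) — impossible on the larger side.
* §2 The maximal rank `r` is not `14`, `8`, `4`, `6`: (G2) `r = 14`: `L⁺` has type `(1|14)`, `L⁻` type `(14|2)`, so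
  every profile has `i + j ≤ 3`, i.e. is `(0, 0)` once `1, 2, 3 ∉ S` — against the non-vanishing lemma
  `UnitaryLeviFull.exists_raise_commute_apply_ne_zero`; (G3) `r = 8`: `L⁺` of type `(7|8)` is full
  (`UnitarySeven.eq_top_of_smul`), §0; (G4) `r = 4`: `L⁺` of type `(11|4)` is full (`UnitaryFourCoprime.eq_top_eleven'`),
  §0; (G5) `r = 6`: `L⁺` has type `(9|6)`, `L⁻` type `(6|10)`; `i ∉ {1, 2, 4, 5}` (mirrored cores `(2|7)`, `(4|5)`,
  `(5|4)` inside `L⁺`, rank one + §0), `j ∉ {1, 3}` (core `(3|7)` inside `L⁻`, rank one on the larger side); the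
  profiles are `(0,0)`, `(0,4)`, `(0,6)`, `(6,0)`; some `X₀` moves `U⁺`, so has profile `(6, 0)`, and two pencils
  (`UnitaryGenericRank.exists_finrank_le_and_finrank_le`) force every profile to be `(·, 0)` — against the
  non-vanishing lemma for `−ι`.
* §3 **`UnitaryFifteenSixteen.eq_top_of_smul_of_maxRank`**: if some raising operator of maximal rank has rank
  `∉ {10, 12}` then `𝔊 = End(W)`; equivalently (`exists_maxRank_of_ne_top`) a proper `𝔊` has a raising operator of
  maximal rank `10` or `12`, and all its raising ranks lie in `{0, 4, 6, 8, 10, 12}`.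

WHAT REMAINS for the `(15 | 16)` core (recorded for the heirs; see the cell README of lit-g87): `r = 12` (Levi types
`(3|12)` / `(12|4)`, profiles `(0,0)`, `(2,2)`, `(3,3)` with `(3,3)` present) and `r = 10` (Levi types `(5|10)` /
`(10|6)`).

## References
* [Ribet1983] K. A. Ribet, *Hodge classes on certain types of abelian varieties*, Amer. J. Math. 105 (1983), Thm. 3.
* [Gordon1997] B. B. Gordon, *A survey of the Hodge conjecture for abelian varieties*, Thm. 6.3 (3), pp. 18–19.
* [Deligne1982HodgeCycles] P. Deligne, *Hodge cycles on abelian varieties*, LNM 900 (1982), I §3 Prop. 3.4, 3.6.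
* [GoodmanWallachGTM255] R. Goodman, N. R. Wallach, GTM 255 (2009), §4.1.1.
* [HoffmanKunze1971LinearAlgebra] K. Hoffman, R. Kunze, *Linear Algebra* (1971), §3.1 Thm. 2, §6.7, §8.3.
-/

noncomputable section

open Module

namespace Literature.AlgebraicGeometry.Motives

namespace HodgeStructure

universe u

variable {W : Type u} [AddCommGroup W] [Module ℂ W]

/-! ### §0 The maximality polarisation, packaged -/

/-- If `B` is a raising operator of maximal rank, `dim(P ∩ U⁺) ≥ 2`, `Q ∩ U⁺ ≠ 0`, and the Levi algebra `L⁺` on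
`U⁺` is full, then `𝔊` contains a rank-one raising operator (`UnitaryLeviFull.exists_rankOne_raise_of_maxRank`); so
if rank one is excluded, `L⁺` is not full. [cite: Deligne1982HodgeCycles, I §3 Prop. 3.4, 3.6]
[cite: GoodmanWallachGTM255, §4.1.1] -/
theorem UnitaryLeviSetup.false_of_full_of_maxRank [FiniteDimensional ℂ W] {𝔊 : Submodule ℂ (Module.End ℂ W)}
    (hbr : ∀ Y ∈ 𝔊, ∀ Z ∈ 𝔊, Y * Z - Z * Y ∈ 𝔊) {Θ : Module.End ℂ W} (hΘ : Θ ∈ 𝔊) (hΘΘ : Θ * Θ = 1)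
    {Q : Submodule ℂ W} (hQ : ∀ x, x ∈ Q ↔ Θ x = -x)
    (hno1 : ∀ B' ∈ 𝔊, Θ * B' = B' → B' * Θ = -B' → Module.finrank ℂ (LinearMap.range B') ≠ 1)
    {B : Module.End ℂ W} (hB : B ∈ 𝔊) (hΘB : Θ * B = B) (hBΘ : B * Θ = -B)
    (hmax : ∀ B' ∈ 𝔊, Θ * B' = B' → B' * Θ = -B' →
      Module.finrank ℂ (LinearMap.range B') ≤ Module.finrank ℂ (LinearMap.range B))
    {ι : Module.End ℂ W} {Up PU QU : Submodule ℂ W} {Lp : Submodule ℂ (Module.End ℂ Up)}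
    (hιι : ι * ι = 1) (hιΘ : ι * Θ = Θ * ι) (hUp : ∀ x, x ∈ Up ↔ ι x = x)
    (hPM : ∀ x, x ∈ LinearMap.range B ↔ ι x = -x ∧ Θ x = x)
    (hQM : ∀ x, x ∈ Q ⊓ LinearMap.ker B ↔ ι x = -x ∧ Θ x = -x)
    (hPU : ∀ x, x ∈ PU ↔ ι x = x ∧ Θ x = x) (hQU : ∀ x, x ∈ QU ↔ ι x = x ∧ Θ x = -x)
    (hPU2 : 2 ≤ Module.finrank ℂ PU) (hQU0 : 0 < Module.finrank ℂ QU)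
    (hLp : ∀ A, A ∈ Lp ↔ ∃ Z ∈ 𝔊, Z * ι = ι * Z ∧ ∀ x : Up, ((A x : Up) : W) = Z x) (hLptop : Lp = ⊤) : False := by
  have hfullp : ∀ T : Module.End ℂ Up, ∃ Z ∈ 𝔊, Z * ι = ι * Z ∧ ∀ v : Up, ((T v : Up) : W) = Z v := fun T =>
    (hLp T).1 (by rw [hLptop]; exact Submodule.mem_top)
  obtain ⟨e₁, he₁, e₂, he₂, he₁0, he₂1⟩ := UnitaryPencil.exists_pair_of_two_le_finrank PU hPU2
  have hind : ∀ a b : ℂ, a • e₁ + b • e₂ = 0 → a = 0 ∧ b = 0 := by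
    intro a b hab
    by_cases hb : b = 0
    · rw [hb, zero_smul, add_zero] at hab
      exact ⟨(smul_eq_zero.1 hab).resolve_right he₁0, hb⟩
    · exfalso
      apply he₂1
      rw [Submodule.mem_span_singleton]
      refine ⟨-(b⁻¹ * a), ?_⟩
      have : e₂ = b⁻¹ • (b • e₂) := by rw [smul_smul, inv_mul_cancel₀ hb, one_smul]
      rw [this, eq_neg_of_add_eq_zero_right hab]
      module
  obtain ⟨⟨c₁, hc₁⟩, hc₁0⟩ := Module.finrank_pos_iff_exists_ne_zero.1 hQU0
  obtain ⟨B₁, hB₁, hΘB₁, hB₁Θ, hr1⟩ := UnitaryLeviFull.exists_rankOne_raise_of_maxRank hbr hΘ hΘΘ hB hΘB hBΘ hmax hιι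
    hιΘ (fun w => ((hPM _).1 (LinearMap.mem_range_self B w)).1)
    (fun v hιv hΘv => LinearMap.mem_ker.1 (Submodule.mem_inf.1 ((hQM v).2 ⟨hιv, hΘv⟩)).2)
    (fun v hΘv hBv => ((hQM v).1 (Submodule.mem_inf.2 ⟨(hQ v).2 hΘv, LinearMap.mem_ker.2 hBv⟩)).1) hUp hfullp
    ((hPU e₁).1 he₁).2 ((hPU e₁).1 he₁).1 ((hPU e₂).1 he₂).2 ((hPU e₂).1 he₂).1 hind ((hQU c₁).1 hc₁).2
    ((hQU c₁).1 hc₁).1 (fun h => hc₁0 (Subtype.ext h))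
  exact hno1 B₁ hB₁ hΘB₁ hB₁Θ hr1

/-! ### §1 No raising operator of rank `2` -/

/-- (G1) At `(15, 16)`, if every raising operator has rank in `{0, 2, …, 14}`, none has rank `2`: at such a `B` the Levi algebra
`L⁺` (type `(13 | 2)`) is full (`UnitaryTwoOdd.eq_top'`); a rank-one element of it lifts to a raising `X` commuting
with `ι` of profile `(1, j)`, `j ≤ 2`, `1 + j` even, so `X|_{U⁻}` is a rank-one raising element of `L⁻` (type
`(2 | 14)`), which is then full (`UnitaryRankOneRaise.eq_top_of_rankOne_raise_two`) — impossible on the larger side.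
[cite: Ribet1983, Thm. 3] [cite: Gordon1997, Thm. 6.3 (3)] [cite: GoodmanWallachGTM255, §4.1.1] -/
theorem UnitaryFifteenSixteen.no_rank_two [FiniteDimensional ℂ W] {𝔊 : Submodule ℂ (Module.End ℂ W)}
    (hbr : ∀ Y ∈ 𝔊, ∀ Z ∈ 𝔊, Y * Z - Z * Y ∈ 𝔊)
    (hirr : ∀ U : Submodule ℂ W, (∀ A ∈ 𝔊, ∀ u ∈ U, A u ∈ U) → U = ⊥ ∨ U = ⊤)
    {Θ : Module.End ℂ W} (hΘ : Θ ∈ 𝔊) (hΘΘ : Θ * Θ = 1)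
    {P Q : Submodule ℂ W} (hP : ∀ x, x ∈ P ↔ Θ x = x) (hQ : ∀ x, x ∈ Q ↔ Θ x = -x)
    (hP15 : Module.finrank ℂ P = 15) (hQ16 : Module.finrank ℂ Q = 16)
    {s : W → W → ℂ} (hadd : ∀ x y z, s (x + y) z = s x z + s y z)
    (hsymm : ∀ x y, s y x = starRingEnd ℂ (s x y))
    (hPQ : ∀ p ∈ P, ∀ q ∈ Q, s p q = 0) (hdefP : ∀ p ∈ P, s p p = 0 → p = 0) (hdefQ : ∀ q ∈ Q, s q q = 0 → q = 0)
    (hadj : ∀ X ∈ 𝔊, ∃ Y ∈ 𝔊, ∀ x y, s (X x) y = s x (Y y))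
    (hS : ∀ B' ∈ 𝔊, Θ * B' = B' → B' * Θ = -B' →
      Module.finrank ℂ (LinearMap.range B') = 0 ∨ Module.finrank ℂ (LinearMap.range B') = 2 ∨
        Module.finrank ℂ (LinearMap.range B') = 4 ∨ Module.finrank ℂ (LinearMap.range B') = 6 ∨
        Module.finrank ℂ (LinearMap.range B') = 8 ∨ Module.finrank ℂ (LinearMap.range B') = 10 ∨
        Module.finrank ℂ (LinearMap.range B') = 12 ∨ Module.finrank ℂ (LinearMap.range B') = 14)
    {B : Module.End ℂ W} (hB : B ∈ 𝔊) (hΘB : Θ * B = B) (hBΘ : B * Θ = -B)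
    (h2 : Module.finrank ℂ (LinearMap.range B) = 2) : False := by
  classical
  have hsU : ∀ U : Submodule ℂ W, ∀ x y z : U, s ((x + y : U) : W) z = s (x : W) z + s (y : W) z :=
    fun U x y z => by simp only [Submodule.coe_add, hadd]
  have hno1 : ∀ B' ∈ 𝔊, Θ * B' = B' → B' * Θ = -B' → Module.finrank ℂ (LinearMap.range B') ≠ 1 := by
    intro B' hB' hΘB' hB'Θ h1
    rcases hS B' hB' hΘB' hB'Θ with h | h | h | h | h | h | h | h <;> omega
  obtain ⟨ι, Um, Up, PU, QU, Lm, ιm, Pm, Qm, Lp, ιp, Pp, Qp, hιmem, hιι, hιΘ, hιs, hUm, hUp, hfinUm, hfinUp,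
    hPM, hQM, hPU, hQU, hrangeP, hPUP, hQUQ, hfinQM, hfinPU, hfinQU, hLm, hLp,
    hιmapply, hPmmem, hQmmem, hbrLm, hirrLm, hιmmem, hιmιm, hPm, hQm, hfinPm, hfinQm, hPmQm, hdefPm, hdefQm, hadjLm,
    hιpapply, hPpmem, hQpmem, hbrLp, hirrLp, hιpmem, hιpιp, hPp, hQp, hfinPp, hfinQp, hPpQp, hdefPp, hdefQp, hadjLp,
    hsplit⟩ :=
    UnitaryLeviSetup.exists_levi_pair hbr hirr hΘ hΘΘ hP hQ hadd hsymm hPQ hdefP hdefQ hadj hB hΘB hBΘ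
  rw [h2] at hfinQM hfinPU hfinQU hfinPm hfinQm hfinPp hfinQp hsplit
  rw [hQ16] at hfinQM hfinQm hfinUm
  rw [hP15] at hfinPU hfinPp hfinUp
  have hcm : ∀ Z : Module.End ℂ W, Z * ι = ι * Z → ∀ x ∈ Um, Z x ∈ Um := fun Z hZ x hx =>
    (hUm _).2 (by rw [← Module.End.mul_apply, ← hZ, Module.End.mul_apply, (hUm x).1 hx, map_neg])
  have hfullm_of : Lm = ⊤ → False := fun h =>
    UnitaryLeviSetup.false_of_full_larger hbr hΘΘ hno1 hιι hιΘ hUm hUp (by omega) (by omega) hPM hQM (by omega)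
      (by omega) hLm h
  -- `L⁺` (type `(13 | 2)`) is full: the `(odd | 2)` core
  have hLptop : Lp = ⊤ :=
    UnitaryTwoOdd.eq_top' hbrLp hirrLp hιpmem hιpιp hPp hQp ⟨6, by omega⟩ hfinQp
      (s := fun v w : Up => s (v : W) w) (hsU Up) (fun v w => hsymm v w) hPpQp hdefPp hdefQp hadjLp
  have hfullp : ∀ T : Module.End ℂ Up, ∃ Z ∈ 𝔊, Z * ι = ι * Z ∧ ∀ v : Up, ((T v : Up) : W) = Z v := fun T =>
    (hLp T).1 (by rw [hLptop]; exact Submodule.mem_top)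
  -- a rank-one lift has profile `(1, 1)`
  obtain ⟨X, hX, hΘX, hXΘ, hXc, hi1⟩ := UnitaryLeviSetup.exists_lift_rankOne hbr hΘ hΘΘ hιΘ hUp hPU hQU (by omega)
    (by omega) hfullp
  obtain ⟨hs, -, -, hj, -⟩ := hsplit X hΘX hXΘ hXc
  have hj1 : Module.finrank ℂ (Um.map X) = 1 := by
    have hr := hS X hX hΘX hXΘ
    rw [hs, hi1] at hr
    omega
  -- so `L⁻` (type `(2 | 14)`) is full — impossible on the larger side
  obtain ⟨hxmem, hιmx, hxιm, hxrk⟩ := UnitaryLeviSetup.restrict_mem hcm hLm hιmapply X hX hΘX hXΘ hXc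
  rw [hj1] at hxrk
  exact hfullm_of (UnitaryRankOneRaise.eq_top_of_rankOne_raise_two hbrLm hirrLm hιmmem hιmιm hPm hQm
    (s := fun v w : Um => s (v : W) w) (hsU Um) (fun v w => hsymm v w) hPmQm hdefPm hdefQm hadjLm hxmem hιmx hxιm
    hxrk hfinPm (by omega))

/-! ### §2 The maximal raising rank is not `14`, `8`, `4`, `6` -/

/-- (G2) At `(15, 16)` with ranks in `{0, 4, 6, …, 14}`, no raising operator has rank `14`: at such a `B` the Levi
types are `(1 | 14)` and `(14 | 2)`, so a raising `X` commuting with `ι` has `rk X = i + j ≤ 1 + 2 = 3`, hence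
`X|_{U⁺} = 0` — but some such `X` moves `U⁺` (`UnitaryLeviFull.exists_raise_commute_apply_ne_zero`).
[cite: Ribet1983, Thm. 3] [cite: Gordon1997, Thm. 6.3 (3)] [cite: Deligne1982HodgeCycles, I §3 Prop. 3.4, 3.6] -/
theorem UnitaryFifteenSixteen.no_rank_fourteen [FiniteDimensional ℂ W] {𝔊 : Submodule ℂ (Module.End ℂ W)}
    (hbr : ∀ Y ∈ 𝔊, ∀ Z ∈ 𝔊, Y * Z - Z * Y ∈ 𝔊)
    (hirr : ∀ U : Submodule ℂ W, (∀ A ∈ 𝔊, ∀ u ∈ U, A u ∈ U) → U = ⊥ ∨ U = ⊤)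
    {Θ : Module.End ℂ W} (hΘ : Θ ∈ 𝔊) (hΘΘ : Θ * Θ = 1)
    {P Q : Submodule ℂ W} (hP : ∀ x, x ∈ P ↔ Θ x = x) (hQ : ∀ x, x ∈ Q ↔ Θ x = -x)
    (hP15 : Module.finrank ℂ P = 15) (hQ16 : Module.finrank ℂ Q = 16)
    {s : W → W → ℂ} (hadd : ∀ x y z, s (x + y) z = s x z + s y z)
    (hsymm : ∀ x y, s y x = starRingEnd ℂ (s x y))
    (hPQ : ∀ p ∈ P, ∀ q ∈ Q, s p q = 0) (hdefP : ∀ p ∈ P, s p p = 0 → p = 0) (hdefQ : ∀ q ∈ Q, s q q = 0 → q = 0)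
    (hadj : ∀ X ∈ 𝔊, ∃ Y ∈ 𝔊, ∀ x y, s (X x) y = s x (Y y))
    (hS : ∀ B' ∈ 𝔊, Θ * B' = B' → B' * Θ = -B' →
      Module.finrank ℂ (LinearMap.range B') = 0 ∨ Module.finrank ℂ (LinearMap.range B') = 4 ∨
        Module.finrank ℂ (LinearMap.range B') = 6 ∨ Module.finrank ℂ (LinearMap.range B') = 8 ∨
        Module.finrank ℂ (LinearMap.range B') = 10 ∨ Module.finrank ℂ (LinearMap.range B') = 12 ∨
        Module.finrank ℂ (LinearMap.range B') = 14)
    {B : Module.End ℂ W} (hB : B ∈ 𝔊) (hΘB : Θ * B = B) (hBΘ : B * Θ = -B)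
    (hr : Module.finrank ℂ (LinearMap.range B) = 14) : False := by
  classical
  have hsU : ∀ U : Submodule ℂ W, ∀ x y z : U, s ((x + y : U) : W) z = s (x : W) z + s (y : W) z :=
    fun U x y z => by simp only [Submodule.coe_add, hadd]
  have hno1 : ∀ B' ∈ 𝔊, Θ * B' = B' → B' * Θ = -B' → Module.finrank ℂ (LinearMap.range B') ≠ 1 := by
    intro B' hB' hΘB' hB'Θ h1
    rcases hS B' hB' hΘB' hB'Θ with h | h | h | h | h | h | h <;> omega
  obtain ⟨ι, Um, Up, PU, QU, Lm, ιm, Pm, Qm, Lp, ιp, Pp, Qp, hιmem, hιι, hιΘ, hιs, hUm, hUp, hfinUm, hfinUp,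
    hPM, hQM, hPU, hQU, hrangeP, hPUP, hQUQ, hfinQM, hfinPU, hfinQU, hLm, hLp,
    hιmapply, hPmmem, hQmmem, hbrLm, hirrLm, hιmmem, hιmιm, hPm, hQm, hfinPm, hfinQm, hPmQm, hdefPm, hdefQm, hadjLm,
    hιpapply, hPpmem, hQpmem, hbrLp, hirrLp, hιpmem, hιpιp, hPp, hQp, hfinPp, hfinQp, hPpQp, hdefPp, hdefQp, hadjLp,
    hsplit⟩ :=
    UnitaryLeviSetup.exists_levi_pair hbr hirr hΘ hΘΘ hP hQ hadd hsymm hPQ hdefP hdefQ hadj hB hΘB hBΘ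
  rw [hr] at hfinQM hfinPU hfinQU hfinPm hfinQm hfinPp hfinQp hsplit
  rw [hQ16] at hfinQM hfinQm hfinUm
  rw [hP15] at hfinPU hfinPp hfinUp
  -- every raising `X` commuting with `ι` vanishes on `U⁺`
  have hiall : ∀ X ∈ 𝔊, Θ * X = X → X * Θ = -X → X * ι = ι * X → Module.finrank ℂ (Up.map X) = 0 := by
    intro X hX hΘX hXΘ hXc
    obtain ⟨hs, hi, hi', hj, hj'⟩ := hsplit X hΘX hXΘ hXc
    have h := hS X hX hΘX hXΘ
    rw [hs] at h
    omega
  -- but some raising `X₀` commuting with `ι` moves `U⁺ ∩ Q`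
  obtain ⟨⟨p, hp⟩, hp0⟩ := Module.finrank_pos_iff_exists_ne_zero.1 (show 0 < Module.finrank ℂ PU by omega)
  obtain ⟨⟨q, hq⟩, hq0⟩ := Module.finrank_pos_iff_exists_ne_zero.1 (show 0 < Module.finrank ℂ QU by omega)
  obtain ⟨X₀, hX₀, hΘX₀, hX₀Θ, hX₀c, c, hιc, hΘc, hX₀c0⟩ :=
    UnitaryLeviFull.exists_raise_commute_apply_ne_zero hbr hirr hΘ hΘΘ hQ hιmem hιι hιΘ hUm hUp
      ⟨p, fun h => hp0 (Subtype.ext h), ((hPU p).1 hp).1, ((hPU p).1 hp).2⟩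
      ⟨q, fun h => hq0 (Subtype.ext h), ((hQU q).1 hq).1, ((hQU q).1 hq).2⟩
  have hmem : X₀ c ∈ Up.map X₀ := Submodule.mem_map_of_mem ((hUp c).2 hιc)
  rw [Submodule.finrank_eq_zero.1 (hiall X₀ hX₀ hΘX₀ hX₀Θ hX₀c), Submodule.mem_bot] at hmem
  exact hX₀c0 hmem

/-- (G3) At `(15, 16)` with ranks in `{0, 4, 6, …, 14}`, a raising operator of MAXIMAL rank does not have rank `8`:
the Levi algebra `L⁺` (type `(7 | 8)`) is full (`UnitarySeven.eq_top_of_smul`, `7 ∤ 8`), and the maximality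
polarisation (§0) produces a rank-one raising operator. [cite: Ribet1983, Thm. 3] [cite: Gordon1997, Thm. 6.3 (3)]
[cite: Deligne1982HodgeCycles, I §3 Prop. 3.4, 3.6] [cite: GoodmanWallachGTM255, §4.1.1] -/
theorem UnitaryFifteenSixteen.no_maxRank_eight [FiniteDimensional ℂ W] {𝔊 : Submodule ℂ (Module.End ℂ W)}
    (hbr : ∀ Y ∈ 𝔊, ∀ Z ∈ 𝔊, Y * Z - Z * Y ∈ 𝔊)
    (hirr : ∀ U : Submodule ℂ W, (∀ A ∈ 𝔊, ∀ u ∈ U, A u ∈ U) → U = ⊥ ∨ U = ⊤)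
    {Θ : Module.End ℂ W} (hΘ : Θ ∈ 𝔊) (hΘΘ : Θ * Θ = 1)
    {P Q : Submodule ℂ W} (hP : ∀ x, x ∈ P ↔ Θ x = x) (hQ : ∀ x, x ∈ Q ↔ Θ x = -x)
    (hP15 : Module.finrank ℂ P = 15)
    {s : W → W → ℂ} (hadd : ∀ x y z, s (x + y) z = s x z + s y z)
    (hsmul : ∀ (c : ℂ) (x y : W), s (c • x) y = c * s x y) (hsymm : ∀ x y, s y x = starRingEnd ℂ (s x y))
    (hPQ : ∀ p ∈ P, ∀ q ∈ Q, s p q = 0) (hdefP : ∀ p ∈ P, s p p = 0 → p = 0) (hdefQ : ∀ q ∈ Q, s q q = 0 → q = 0)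
    (hadj : ∀ X ∈ 𝔊, ∃ Y ∈ 𝔊, ∀ x y, s (X x) y = s x (Y y))
    (hS : ∀ B' ∈ 𝔊, Θ * B' = B' → B' * Θ = -B' →
      Module.finrank ℂ (LinearMap.range B') = 0 ∨ Module.finrank ℂ (LinearMap.range B') = 4 ∨
        Module.finrank ℂ (LinearMap.range B') = 6 ∨ Module.finrank ℂ (LinearMap.range B') = 8 ∨
        Module.finrank ℂ (LinearMap.range B') = 10 ∨ Module.finrank ℂ (LinearMap.range B') = 12 ∨
        Module.finrank ℂ (LinearMap.range B') = 14)
    {B : Module.End ℂ W} (hB : B ∈ 𝔊) (hΘB : Θ * B = B) (hBΘ : B * Θ = -B)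
    (hmax : ∀ B' ∈ 𝔊, Θ * B' = B' → B' * Θ = -B' →
      Module.finrank ℂ (LinearMap.range B') ≤ Module.finrank ℂ (LinearMap.range B))
    (hr : Module.finrank ℂ (LinearMap.range B) = 8) : False := by
  classical
  have hsU : ∀ U : Submodule ℂ W, ∀ x y z : U, s ((x + y : U) : W) z = s (x : W) z + s (y : W) z :=
    fun U x y z => by simp only [Submodule.coe_add, hadd]
  have hno1 : ∀ B' ∈ 𝔊, Θ * B' = B' → B' * Θ = -B' → Module.finrank ℂ (LinearMap.range B') ≠ 1 := by
    intro B' hB' hΘB' hB'Θ h1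
    rcases hS B' hB' hΘB' hB'Θ with h | h | h | h | h | h | h <;> omega
  obtain ⟨ι, Um, Up, PU, QU, Lm, ιm, Pm, Qm, Lp, ιp, Pp, Qp, hιmem, hιι, hιΘ, hιs, hUm, hUp, hfinUm, hfinUp,
    hPM, hQM, hPU, hQU, hrangeP, hPUP, hQUQ, hfinQM, hfinPU, hfinQU, hLm, hLp,
    hιmapply, hPmmem, hQmmem, hbrLm, hirrLm, hιmmem, hιmιm, hPm, hQm, hfinPm, hfinQm, hPmQm, hdefPm, hdefQm, hadjLm,
    hιpapply, hPpmem, hQpmem, hbrLp, hirrLp, hιpmem, hιpιp, hPp, hQp, hfinPp, hfinQp, hPpQp, hdefPp, hdefQp, hadjLp,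
    hsplit⟩ :=
    UnitaryLeviSetup.exists_levi_pair hbr hirr hΘ hΘΘ hP hQ hadd hsymm hPQ hdefP hdefQ hadj hB hΘB hBΘ
  rw [hr] at hfinQM hfinPU hfinQU hfinPm hfinQm hfinPp hfinQp hsplit hmax
  rw [hP15] at hfinPU hfinPp hfinUp
  have hsmU : ∀ U : Submodule ℂ W, ∀ (c : ℂ) (x y : U), s ((c • x : U) : W) y = c * s (x : W) y :=
    fun U c x y => by simp only [Submodule.coe_smul, hsmul]
  -- `L⁺` (type `(7 | 8)`) is full
  have hLptop : Lp = ⊤ :=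
    UnitarySeven.eq_top_of_smul hbrLp hirrLp hιpmem hιpιp hPp hQp (by omega) (by omega)
      (s := fun v w : Up => s (v : W) w) (hsU Up) (hsmU Up) (fun v w => hsymm v w) hPpQp hdefPp hdefQp hadjLp
  exact UnitaryLeviSetup.false_of_full_of_maxRank hbr hΘ hΘΘ hQ hno1 hB hΘB hBΘ (by rw [hr]; exact hmax) hιι hιΘ hUp
    hPM hQM hPU hQU (by omega) (by omega) hLp hLptop

/-- (G4) At `(15, 16)` with ranks in `{0, 4, 6, …, 14}`, a raising operator of MAXIMAL rank does not have rank `4`: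
the Levi algebra `L⁺` (type `(11 | 4)`) is full (`UnitaryFourCoprime.eq_top_eleven'`), and the maximality
polarisation (§0) produces a rank-one raising operator. [cite: Ribet1983, Thm. 3] [cite: Gordon1997, Thm. 6.3 (3)]
[cite: Deligne1982HodgeCycles, I §3 Prop. 3.4, 3.6] [cite: GoodmanWallachGTM255, §4.1.1] -/
theorem UnitaryFifteenSixteen.no_maxRank_four [FiniteDimensional ℂ W] {𝔊 : Submodule ℂ (Module.End ℂ W)}
    (hbr : ∀ Y ∈ 𝔊, ∀ Z ∈ 𝔊, Y * Z - Z * Y ∈ 𝔊)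
    (hirr : ∀ U : Submodule ℂ W, (∀ A ∈ 𝔊, ∀ u ∈ U, A u ∈ U) → U = ⊥ ∨ U = ⊤)
    {Θ : Module.End ℂ W} (hΘ : Θ ∈ 𝔊) (hΘΘ : Θ * Θ = 1)
    {P Q : Submodule ℂ W} (hP : ∀ x, x ∈ P ↔ Θ x = x) (hQ : ∀ x, x ∈ Q ↔ Θ x = -x)
    (hP15 : Module.finrank ℂ P = 15)
    {s : W → W → ℂ} (hadd : ∀ x y z, s (x + y) z = s x z + s y z)
    (hsymm : ∀ x y, s y x = starRingEnd ℂ (s x y))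
    (hPQ : ∀ p ∈ P, ∀ q ∈ Q, s p q = 0) (hdefP : ∀ p ∈ P, s p p = 0 → p = 0) (hdefQ : ∀ q ∈ Q, s q q = 0 → q = 0)
    (hadj : ∀ X ∈ 𝔊, ∃ Y ∈ 𝔊, ∀ x y, s (X x) y = s x (Y y))
    (hS : ∀ B' ∈ 𝔊, Θ * B' = B' → B' * Θ = -B' →
      Module.finrank ℂ (LinearMap.range B') = 0 ∨ Module.finrank ℂ (LinearMap.range B') = 4 ∨
        Module.finrank ℂ (LinearMap.range B') = 6 ∨ Module.finrank ℂ (LinearMap.range B') = 8 ∨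
        Module.finrank ℂ (LinearMap.range B') = 10 ∨ Module.finrank ℂ (LinearMap.range B') = 12 ∨
        Module.finrank ℂ (LinearMap.range B') = 14)
    {B : Module.End ℂ W} (hB : B ∈ 𝔊) (hΘB : Θ * B = B) (hBΘ : B * Θ = -B)
    (hmax : ∀ B' ∈ 𝔊, Θ * B' = B' → B' * Θ = -B' →
      Module.finrank ℂ (LinearMap.range B') ≤ Module.finrank ℂ (LinearMap.range B))
    (hr : Module.finrank ℂ (LinearMap.range B) = 4) : False := by
  classical
  have hsU : ∀ U : Submodule ℂ W, ∀ x y z : U, s ((x + y : U) : W) z = s (x : W) z + s (y : W) z :=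
    fun U x y z => by simp only [Submodule.coe_add, hadd]
  have hno1 : ∀ B' ∈ 𝔊, Θ * B' = B' → B' * Θ = -B' → Module.finrank ℂ (LinearMap.range B') ≠ 1 := by
    intro B' hB' hΘB' hB'Θ h1
    rcases hS B' hB' hΘB' hB'Θ with h | h | h | h | h | h | h <;> omega
  obtain ⟨ι, Um, Up, PU, QU, Lm, ιm, Pm, Qm, Lp, ιp, Pp, Qp, hιmem, hιι, hιΘ, hιs, hUm, hUp, hfinUm, hfinUp,
    hPM, hQM, hPU, hQU, hrangeP, hPUP, hQUQ, hfinQM, hfinPU, hfinQU, hLm, hLp,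
    hιmapply, hPmmem, hQmmem, hbrLm, hirrLm, hιmmem, hιmιm, hPm, hQm, hfinPm, hfinQm, hPmQm, hdefPm, hdefQm, hadjLm,
    hιpapply, hPpmem, hQpmem, hbrLp, hirrLp, hιpmem, hιpιp, hPp, hQp, hfinPp, hfinQp, hPpQp, hdefPp, hdefQp, hadjLp,
    hsplit⟩ :=
    UnitaryLeviSetup.exists_levi_pair hbr hirr hΘ hΘΘ hP hQ hadd hsymm hPQ hdefP hdefQ hadj hB hΘB hBΘ
  rw [hr] at hfinQM hfinPU hfinQU hfinPm hfinQm hfinPp hfinQp hsplit hmax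
  rw [hP15] at hfinPU hfinPp hfinUp
  -- `L⁺` (type `(11 | 4)`) is full
  have hLptop : Lp = ⊤ :=
    UnitaryFourCoprime.eq_top_eleven' hbrLp hirrLp hιpmem hιpιp hPp hQp (by omega) (by omega)
      (s := fun v w : Up => s (v : W) w) (hsU Up) (fun v w => hsymm v w) hPpQp hdefPp hdefQp hadjLp
  exact UnitaryLeviSetup.false_of_full_of_maxRank hbr hΘ hΘΘ hQ hno1 hB hΘB hBΘ (by rw [hr]; exact hmax) hιι hιΘ hUp
    hPM hQM hPU hQU (by omega) (by omega) hLp hLptop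

/-- (G5) At `(15, 16)` with ranks in `{0, 4, 6, …, 14}`, a raising operator of MAXIMAL rank does not have rank `6`.
At such a `B` the Levi types are `(9 | 6)` (`L⁺`) and `(6 | 10)` (`L⁻`). KILLS: `i ∉ {1, 2, 4, 5}` (a rank-one
raising element makes `L⁺` full, `UnitaryRankOneRaise.eq_top_of_rankOne_raise`; the mirrored double Levi inside `L⁺`
with the cores `(2 | 7)`, `(4 | 5)`, `(5 | 4)` makes `L⁺` full; a full `L⁺` contradicts maximality, §0) and
`j ∉ {1, 3}` (rank one resp. the core `(3 | 7)` inside `L⁻` make `L⁻` full — impossible on the larger side). With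
`i, j ≤ 6`, `i + j ∈ {0, 4, 6}` the profiles are `(0,0)`, `(0,4)`, `(0,6)`, `(6,0)`. Some `X₀` moves `U⁺`
(`UnitaryLeviFull.exists_raise_commute_apply_ne_zero`), so has profile `(6, 0)`; for any `Y` a member `X₀ + cY` of the
pencil has `i ≥ 6`, hence profile `(6, 0)`, and `j(Y) ≤ j(X₀ + cY) = 0` (two pencils,
`UnitaryGenericRank.exists_finrank_le_and_finrank_le`): every profile is `(·, 0)` — against the non-vanishing lemma
for `−ι`. [cite: Ribet1983, Thm. 3] [cite: Gordon1997, Thm. 6.3 (3)] [cite: Deligne1982HodgeCycles, I §3 Prop. 3.4, 3.6]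
[cite: GoodmanWallachGTM255, §4.1.1] [cite: HoffmanKunze1971LinearAlgebra, §3.1 Thm. 2] -/
theorem UnitaryFifteenSixteen.no_maxRank_six [FiniteDimensional ℂ W] {𝔊 : Submodule ℂ (Module.End ℂ W)}
    (hbr : ∀ Y ∈ 𝔊, ∀ Z ∈ 𝔊, Y * Z - Z * Y ∈ 𝔊)
    (hirr : ∀ U : Submodule ℂ W, (∀ A ∈ 𝔊, ∀ u ∈ U, A u ∈ U) → U = ⊥ ∨ U = ⊤)
    {Θ : Module.End ℂ W} (hΘ : Θ ∈ 𝔊) (hΘΘ : Θ * Θ = 1)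
    {P Q : Submodule ℂ W} (hP : ∀ x, x ∈ P ↔ Θ x = x) (hQ : ∀ x, x ∈ Q ↔ Θ x = -x)
    (hP15 : Module.finrank ℂ P = 15) (hQ16 : Module.finrank ℂ Q = 16)
    {s : W → W → ℂ} (hadd : ∀ x y z, s (x + y) z = s x z + s y z)
    (hsymm : ∀ x y, s y x = starRingEnd ℂ (s x y))
    (hPQ : ∀ p ∈ P, ∀ q ∈ Q, s p q = 0) (hdefP : ∀ p ∈ P, s p p = 0 → p = 0) (hdefQ : ∀ q ∈ Q, s q q = 0 → q = 0)
    (hadj : ∀ X ∈ 𝔊, ∃ Y ∈ 𝔊, ∀ x y, s (X x) y = s x (Y y))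
    (hS : ∀ B' ∈ 𝔊, Θ * B' = B' → B' * Θ = -B' →
      Module.finrank ℂ (LinearMap.range B') = 0 ∨ Module.finrank ℂ (LinearMap.range B') = 4 ∨
        Module.finrank ℂ (LinearMap.range B') = 6 ∨ Module.finrank ℂ (LinearMap.range B') = 8 ∨
        Module.finrank ℂ (LinearMap.range B') = 10 ∨ Module.finrank ℂ (LinearMap.range B') = 12 ∨
        Module.finrank ℂ (LinearMap.range B') = 14)
    {B : Module.End ℂ W} (hB : B ∈ 𝔊) (hΘB : Θ * B = B) (hBΘ : B * Θ = -B)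
    (hmax : ∀ B' ∈ 𝔊, Θ * B' = B' → B' * Θ = -B' →
      Module.finrank ℂ (LinearMap.range B') ≤ Module.finrank ℂ (LinearMap.range B))
        (hr : Module.finrank ℂ (LinearMap.range B) = 6) : False := by
  classical
  have hsU : ∀ U : Submodule ℂ W, ∀ x y z : U, s ((x + y : U) : W) z = s (x : W) z + s (y : W) z :=
    fun U x y z => by simp only [Submodule.coe_add, hadd]
  have hno1 : ∀ B' ∈ 𝔊, Θ * B' = B' → B' * Θ = -B' → Module.finrank ℂ (LinearMap.range B') ≠ 1 := by
    intro B' hB' hΘB' hB'Θ h1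
    rcases hS B' hB' hΘB' hB'Θ with h | h | h | h | h | h | h <;> omega
  obtain ⟨ι, Um, Up, PU, QU, Lm, ιm, Pm, Qm, Lp, ιp, Pp, Qp, hιmem, hιι, hιΘ, hιs, hUm, hUp, hfinUm, hfinUp,
    hPM, hQM, hPU, hQU, hrangeP, hPUP, hQUQ, hfinQM, hfinPU, hfinQU, hLm, hLp,
    hιmapply, hPmmem, hQmmem, hbrLm, hirrLm, hιmmem, hιmιm, hPm, hQm, hfinPm, hfinQm, hPmQm, hdefPm, hdefQm, hadjLm,
    hιpapply, hPpmem, hQpmem, hbrLp, hirrLp, hιpmem, hιpιp, hPp, hQp, hfinPp, hfinQp, hPpQp, hdefPp, hdefQp, hadjLp,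
    hsplit⟩ :=
    UnitaryLeviSetup.exists_levi_pair hbr hirr hΘ hΘΘ hP hQ hadd hsymm hPQ hdefP hdefQ hadj hB hΘB hBΘ
  rw [hr] at hfinQM hfinPU hfinQU hfinPm hfinQm hfinPp hfinQp hsplit hmax
  rw [hQ16] at hfinQM hfinQm hfinUm
  rw [hP15] at hfinPU hfinPp hfinUp
  have hcm : ∀ Z : Module.End ℂ W, Z * ι = ι * Z → ∀ x ∈ Um, Z x ∈ Um := fun Z hZ x hx =>
    (hUm _).2 (by rw [← Module.End.mul_apply, ← hZ, Module.End.mul_apply, (hUm x).1 hx, map_neg])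
  have hcp : ∀ Z : Module.End ℂ W, Z * ι = ι * Z → ∀ x ∈ Up, Z x ∈ Up := fun Z hZ x hx =>
    (hUp _).2 (by rw [← Module.End.mul_apply, ← hZ, Module.End.mul_apply, (hUp x).1 hx])
  have hfullm_of : Lm = ⊤ → False := fun h =>
    UnitaryLeviSetup.false_of_full_larger hbr hΘΘ hno1 hιι hιΘ hUm hUp (by omega) (by omega) hPM hQM (by omega)
      (by omega) hLm h
  have hfullp_of : Lp = ⊤ → False := fun h =>
    UnitaryLeviSetup.false_of_full_of_maxRank hbr hΘ hΘΘ hQ hno1 hB hΘB hBΘ (by rw [hr]; exact hmax) hιι hιΘ hUp hPM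
      hQM hPU hQU (by omega) (by omega) hLp h
  -- kills in `L⁺` (type `(9 | 6)`): `i ∉ {1, 2, 4, 5}`
  have hkillp : ∀ X ∈ 𝔊, Θ * X = X → X * Θ = -X → X * ι = ι * X →
      Module.finrank ℂ (Up.map X) ≠ 1 ∧ Module.finrank ℂ (Up.map X) ≠ 2 ∧ Module.finrank ℂ (Up.map X) ≠ 4 ∧
        Module.finrank ℂ (Up.map X) ≠ 5 := by
    intro X hX hΘX hXΘ hXc
    obtain ⟨hymem, hιpy, hyιp, hyrk⟩ := UnitaryLeviSetup.restrict_mem hcp hLp hιpapply X hX hΘX hXΘ hXc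
    have hk1 : Module.finrank ℂ (Up.map X) = 1 → False := fun hi => by
      rw [hi] at hyrk
      exact hfullp_of (UnitaryRankOneRaise.eq_top_of_rankOne_raise hbrLp hirrLp hιpmem hιpιp hPp hQp
        (s := fun v w : Up => s (v : W) w) (hsU Up) (fun v w => hsymm v w) hPpQp hdefPp hdefQp hadjLp hymem hιpy hyιp
        hyrk (by omega) (by omega) (by omega))
    have hk : ∀ i, Module.finrank ℂ (Up.map X) = i → (i = 2 ∨ i = 4 ∨ i = 5) → False := by
      intro i hi his
      rw [hi] at hyrk
      refine hfullp_of (UnitaryDoubleLevi.eq_top_of_raise_of_core' hbrLp hirrLp hιpmem hιpιp hPp hQp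
        (s := fun v w : Up => s (v : W) w) (hsU Up) (fun v w => hsymm v w) hPpQp hdefPp hdefQp hadjLp hymem hιpy hyιp
        (by rw [hyrk]; omega) (by omega) (by omega)
        fun U' 𝔩' ι' P' Q' hbr𝔩' hirr𝔩' hι' hι'ι' hP' hQ' hfinP' hfinQ' hP'Q' hdefP' hdefQ' hadj𝔩' => ?_)
      rw [hyrk] at hfinP' hfinQ'
      rcases his with rfl | rfl | rfl
      · -- `(2 | 7)`
        exact UnitaryTwoOdd.eq_top hbr𝔩' hirr𝔩' hι' hι'ι' hP' hQ' hfinP' ⟨3, by omega⟩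
          (s := fun v w : U' => s ((v : Up) : W) w) (fun v w z => by simp only [Submodule.coe_add, hadd])
          (fun v w => hsymm _ _) hP'Q' hdefP' hdefQ' hadj𝔩'
      · -- `(4 | 5)`
        exact UnitaryFourOdd.eq_top hbr𝔩' hirr𝔩' hι' hι'ι' hP' hQ' hfinP' ⟨2, by omega⟩
          (s := fun v w : U' => s ((v : Up) : W) w) (fun v w z => by simp only [Submodule.coe_add, hadd])
          (fun v w => hsymm _ _) hP'Q' hdefP' hdefQ' hadj𝔩'
      · -- `(5 | 4)`
        exact UnitaryFive.eq_top hbr𝔩' hirr𝔩' hι' hι'ι' hP' hQ' hfinP' (Or.inr (by omega))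
          (s := fun v w : U' => s ((v : Up) : W) w) (fun v w z => by simp only [Submodule.coe_add, hadd])
          (fun v w => hsymm _ _) hP'Q' hdefP' hdefQ' hadj𝔩'
    exact ⟨hk1, fun h => hk 2 h (by omega), fun h => hk 4 h (by omega), fun h => hk 5 h (by omega)⟩
  -- kills in `L⁻` (type `(6 | 10)`): `j ∉ {1, 3}`
  have hkillm : ∀ X ∈ 𝔊, Θ * X = X → X * Θ = -X → X * ι = ι * X →
      Module.finrank ℂ (Um.map X) ≠ 1 ∧ Module.finrank ℂ (Um.map X) ≠ 3 := by
    intro X hX hΘX hXΘ hXc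
    obtain ⟨hxmem, hιmx, hxιm, hxrk⟩ := UnitaryLeviSetup.restrict_mem hcm hLm hιmapply X hX hΘX hXΘ hXc
    refine ⟨fun hj => ?_, fun hj => ?_⟩
    · rw [hj] at hxrk
      exact hfullm_of (UnitaryRankOneRaise.eq_top_of_rankOne_raise hbrLm hirrLm hιmmem hιmιm hPm hQm
        (s := fun v w : Um => s (v : W) w) (hsU Um) (fun v w => hsymm v w) hPmQm hdefPm hdefQm hadjLm hxmem hιmx hxιm
        hxrk (by omega) (by omega) (by omega))
    · rw [hj] at hxrk
      refine hfullm_of (UnitaryDoubleLevi.eq_top_of_raise_of_core hbrLm hirrLm hιmmem hιmιm hPm hQm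
        (s := fun v w : Um => s (v : W) w) (hsU Um) (fun v w => hsymm v w) hPmQm hdefPm hdefQm hadjLm hxmem hιmx hxιm
        (by rw [hxrk]; omega) (by omega) (by omega)
        fun U' 𝔩' ι' P' Q' hbr𝔩' hirr𝔩' hι' hι'ι' hP' hQ' hfinP' hfinQ' hP'Q' hdefP' hdefQ' hadj𝔩' => ?_)
      rw [hxrk] at hfinP' hfinQ'
      -- `(3 | 7)`
      exact UnitaryThreeCoprime.eq_top hbr𝔩' hirr𝔩' hι' hι'ι' hP' hQ' hfinP' (by omega)
        (s := fun v w : U' => s ((v : Um) : W) w) (fun v w z => by simp only [Submodule.coe_add, hadd])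
        (fun v w => hsymm _ _) hP'Q' hdefP' hdefQ' hadj𝔩'
  -- the profiles are `(0, 0)`, `(0, 4)`, `(0, 6)`, `(6, 0)`
  have hprof : ∀ X ∈ 𝔊, Θ * X = X → X * Θ = -X → X * ι = ι * X →
      (Module.finrank ℂ (Up.map X) = 0 ∧ Module.finrank ℂ (Um.map X) = 0) ∨
        (Module.finrank ℂ (Up.map X) = 0 ∧ Module.finrank ℂ (Um.map X) = 4) ∨
        (Module.finrank ℂ (Up.map X) = 0 ∧ Module.finrank ℂ (Um.map X) = 6) ∨
        (Module.finrank ℂ (Up.map X) = 6 ∧ Module.finrank ℂ (Um.map X) = 0) := by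
    intro X hX hΘX hXΘ hXc
    obtain ⟨hs, hi, hi', hj, hj'⟩ := hsplit X hΘX hXΘ hXc
    obtain ⟨hp1, hp2, hp4, hp5⟩ := hkillp X hX hΘX hXΘ hXc
    obtain ⟨hm1, hm3⟩ := hkillm X hX hΘX hXΘ hXc
    have hr' := hS X hX hΘX hXΘ
    have hle := hmax X hX hΘX hXΘ
    rw [hs] at hr' hle
    omega
  -- some `X₀` moves `U⁺`; it has profile `(6, 0)`
  obtain ⟨⟨p, hp⟩, hp0⟩ := Module.finrank_pos_iff_exists_ne_zero.1 (show 0 < Module.finrank ℂ PU by omega)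
  obtain ⟨⟨q, hq⟩, hq0⟩ := Module.finrank_pos_iff_exists_ne_zero.1 (show 0 < Module.finrank ℂ QU by omega)
  obtain ⟨X₀, hX₀, hΘX₀, hX₀Θ, hX₀c, c, hιc, hΘc, hX₀c0⟩ :=
    UnitaryLeviFull.exists_raise_commute_apply_ne_zero hbr hirr hΘ hΘΘ hQ hιmem hιι hιΘ hUm hUp
      ⟨p, fun h => hp0 (Subtype.ext h), ((hPU p).1 hp).1, ((hPU p).1 hp).2⟩
      ⟨q, fun h => hq0 (Subtype.ext h), ((hQU q).1 hq).1, ((hQU q).1 hq).2⟩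
  have hX₀i : Module.finrank ℂ (Up.map X₀) = 6 := by
    have hmem : X₀ c ∈ Up.map X₀ := Submodule.mem_map_of_mem ((hUp c).2 hιc)
    rcases hprof X₀ hX₀ hΘX₀ hX₀Θ hX₀c with ⟨h0, -⟩ | ⟨h0, -⟩ | ⟨h0, -⟩ | ⟨h6, -⟩
    · rw [Submodule.finrank_eq_zero.1 h0, Submodule.mem_bot] at hmem; exact absurd hmem hX₀c0
    · rw [Submodule.finrank_eq_zero.1 h0, Submodule.mem_bot] at hmem; exact absurd hmem hX₀c0
    · rw [Submodule.finrank_eq_zero.1 h0, Submodule.mem_bot] at hmem; exact absurd hmem hX₀c0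
    · exact h6
  -- two pencils: EVERY raising `Y` commuting with `ι` vanishes on `U⁻`
  have hjall : ∀ Y ∈ 𝔊, Θ * Y = Y → Y * Θ = -Y → Y * ι = ι * Y → Module.finrank ℂ (Um.map Y) = 0 := by
    intro Y hY hΘY hYΘ hYc
    obtain ⟨c', hc1, hc2⟩ := UnitaryGenericRank.exists_finrank_le_and_finrank_le (Y.restrict (hcm Y hYc))
      (X₀.restrict (hcm X₀ hX₀c)) (X₀.restrict (hcp X₀ hX₀c)) (Y.restrict (hcp Y hYc))
    obtain ⟨hX₁, hΘX₁, hX₁Θ, hX₁c⟩ := UnitaryLeviSetup.add_smul_raise X₀ hX₀ hΘX₀ hX₀Θ hX₀c Y hY hΘY hYΘ hYc c'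
    have hi₁ := UnitaryLeviSetup.finrank_map_add_smul hcp X₀ Y hX₀c hYc c' hX₁c
    have hj₁ := UnitaryLeviSetup.finrank_map_add_smul hcm X₀ Y hX₀c hYc c' hX₁c
    have hx₀' : Module.finrank ℂ (LinearMap.range (X₀.restrict (hcp X₀ hX₀c))) = 6 := by
      rw [UnitaryLeviRank.finrank_range_restrict, hX₀i]
    have hy : Module.finrank ℂ (LinearMap.range (Y.restrict (hcm Y hYc))) = Module.finrank ℂ (Um.map Y) :=
      UnitaryLeviRank.finrank_range_restrict _
    have hp' := hprof (X₀ + c' • Y) hX₁ hΘX₁ hX₁Θ hX₁c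
    rw [hi₁, hj₁] at hp'
    omega
  -- but some raising `Y` commuting with `ι` moves `U⁻ ∩ Q` (the non-vanishing lemma for `−ι`)
  have hnι : -ι ∈ 𝔊 := Submodule.neg_mem _ hιmem
  have hnιι : (-ι) * (-ι) = 1 := by rw [neg_mul_neg, hιι]
  have hnιΘ : (-ι) * Θ = Θ * (-ι) := by rw [neg_mul, mul_neg, hιΘ]
  have hUm' : ∀ x, x ∈ Um ↔ (-ι) x = x := fun x => by rw [hUm, LinearMap.neg_apply, neg_eq_iff_eq_neg]
  have hUp' : ∀ x, x ∈ Up ↔ (-ι) x = -x := fun x => by rw [hUp, LinearMap.neg_apply, neg_inj]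
  obtain ⟨⟨u, hu⟩, hu0⟩ := Module.finrank_pos_iff_exists_ne_zero.1
    (show 0 < Module.finrank ℂ (LinearMap.range B) by omega)
  obtain ⟨⟨d₀, hd₀⟩, hd₀0⟩ := Module.finrank_pos_iff_exists_ne_zero.1
    (show 0 < Module.finrank ℂ ↥(Q ⊓ LinearMap.ker B) by omega)
  obtain ⟨Y, hY, hΘY, hYΘ, hYc', d, hιd, hΘd, hYd⟩ :=
    UnitaryLeviFull.exists_raise_commute_apply_ne_zero hbr hirr hΘ hΘΘ hQ hnι hnιι hnιΘ hUp' hUm'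
      ⟨u, fun h => hu0 (Subtype.ext h), by rw [LinearMap.neg_apply, ((hPM u).1 hu).1, neg_neg], ((hPM u).1 hu).2⟩
      ⟨d₀, fun h => hd₀0 (Subtype.ext h), by rw [LinearMap.neg_apply, ((hQM d₀).1 hd₀).1, neg_neg], ((hQM d₀).1 hd₀).2⟩
  have hYc : Y * ι = ι * Y := by rw [mul_neg, neg_mul, neg_inj] at hYc'; exact hYc'
  have h0 := hjall Y hY hΘY hYΘ hYc
  have hmem : Y d ∈ Um.map Y := Submodule.mem_map_of_mem ((hUm' d).2 hιd)
  rw [Submodule.finrank_eq_zero.1 h0, Submodule.mem_bot] at hmem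
  exact hYd hmem

/-! ### §3 The reduction: a proper `𝔊` has maximal raising rank `10` or `12` -/

/-- A raising operator of maximal rank exists (ranks are bounded by `dim W`). [cite: HoffmanKunze1971LinearAlgebra, §3.1 Thm. 2] -/
theorem UnitaryRaisingSpace.exists_maxRank_raise [FiniteDimensional ℂ W] (𝔊 : Submodule ℂ (Module.End ℂ W))
    (Θ : Module.End ℂ W) :
    ∃ B ∈ 𝔊, Θ * B = B ∧ B * Θ = -B ∧
      ∀ B' ∈ 𝔊, Θ * B' = B' → B' * Θ = -B' →
        Module.finrank ℂ (LinearMap.range B') ≤ Module.finrank ℂ (LinearMap.range B) := by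
  classical
  set p : ℕ → Prop := fun n => ∃ B ∈ 𝔊, Θ * B = B ∧ B * Θ = -B ∧ Module.finrank ℂ (LinearMap.range B) = n with hp
  have h0 : p 0 := ⟨0, Submodule.zero_mem _, mul_zero Θ, by rw [zero_mul, neg_zero], by
    rw [LinearMap.range_zero, finrank_bot]⟩
  obtain ⟨B, hB, hΘB, hBΘ, hBn⟩ : p (Nat.findGreatest p (Module.finrank ℂ W)) :=
    Nat.findGreatest_spec (Nat.zero_le _) h0
  refine ⟨B, hB, hΘB, hBΘ, fun B' hB' hΘB' hB'Θ => ?_⟩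
  rw [hBn]
  exact Nat.le_findGreatest (Submodule.finrank_le _) ⟨B', hB', hΘB', hB'Θ, rfl⟩

/-- **THE `(15 | 16)` REDUCTION.** `𝔊 ⊆ End(W)` bracket-closed and irreducible, `Θ ∈ 𝔊` an involution with
`dim P = 15`, `dim Q = 16`, Hermitian data (`s` additive and `ℂ`-homogeneous in the first slot, Hermitian-symmetric,
`P ⊥ Q`, definite on `P` and on `Q`), `𝔊` adjoint-closed. If some raising operator `B` of maximal rank has
`rk B ∉ {10, 12}`, then `𝔊 = End(W)`: the odd ranks are good (larger-side Levi types `(1|15)`, `(3|13)`, `(5|11)`,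
`(7|9)`, `(9|7)`, `(11|5)`, `(13|3)`, `(15|1)` are tree cores, `UnitaryDoubleLevi.eq_top_of_raise_of_core`), `2` is
absent (§1), and a maximal rank `0`, `4`, `6`, `8`, `14` is impossible (`UnitaryThreeCoprime.exists_raise_rank_ge_two`,
§2). [cite: Ribet1983, Thm. 3] [cite: Gordon1997, Thm. 6.3 (3)] [cite: Deligne1982HodgeCycles, I §3 Prop. 3.4, 3.6]
[cite: GoodmanWallachGTM255, §4.1.1] -/
theorem UnitaryFifteenSixteen.eq_top_of_smul_of_maxRank [FiniteDimensional ℂ W] {𝔊 : Submodule ℂ (Module.End ℂ W)}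
    (hbr : ∀ Y ∈ 𝔊, ∀ Z ∈ 𝔊, Y * Z - Z * Y ∈ 𝔊)
    (hirr : ∀ U : Submodule ℂ W, (∀ A ∈ 𝔊, ∀ u ∈ U, A u ∈ U) → U = ⊥ ∨ U = ⊤)
    {Θ : Module.End ℂ W} (hΘ : Θ ∈ 𝔊) (hΘΘ : Θ * Θ = 1)
    {P Q : Submodule ℂ W} (hP : ∀ x, x ∈ P ↔ Θ x = x) (hQ : ∀ x, x ∈ Q ↔ Θ x = -x)
    (hP15 : Module.finrank ℂ P = 15) (hQ16 : Module.finrank ℂ Q = 16)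
    {s : W → W → ℂ} (hadd : ∀ x y z, s (x + y) z = s x z + s y z)
    (hsmul : ∀ (c : ℂ) (x y : W), s (c • x) y = c * s x y) (hsymm : ∀ x y, s y x = starRingEnd ℂ (s x y))
    (hPQ : ∀ p ∈ P, ∀ q ∈ Q, s p q = 0) (hdefP : ∀ p ∈ P, s p p = 0 → p = 0) (hdefQ : ∀ q ∈ Q, s q q = 0 → q = 0)
    (hadj : ∀ X ∈ 𝔊, ∃ Y ∈ 𝔊, ∀ x y, s (X x) y = s x (Y y))
    {B : Module.End ℂ W} (hB : B ∈ 𝔊) (hΘB : Θ * B = B) (hBΘ : B * Θ = -B)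
    (hmax : ∀ B' ∈ 𝔊, Θ * B' = B' → B' * Θ = -B' →
      Module.finrank ℂ (LinearMap.range B') ≤ Module.finrank ℂ (LinearMap.range B))
    (h10 : Module.finrank ℂ (LinearMap.range B) ≠ 10) (h12 : Module.finrank ℂ (LinearMap.range B) ≠ 12) :
    𝔊 = ⊤ := by
  classical
  have hraiseval : ∀ Z : Module.End ℂ W, Θ * Z = Z → ∀ w, Z w ∈ P := fun Z hΘZ w =>
    (hP _).2 (by rw [← Module.End.mul_apply, hΘZ])
  have hle15 : ∀ B' : Module.End ℂ W, Θ * B' = B' → Module.finrank ℂ (LinearMap.range B') ≤ 15 := fun B' h => by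
    rw [← hP15]
    exact Submodule.finrank_mono (by rintro _ ⟨w, rfl⟩; exact hraiseval B' h w)
  have hsU : ∀ U : Submodule ℂ W, ∀ x y z : U, s ((x + y : U) : W) z = s (x : W) z + s (y : W) z :=
    fun U x y z => by simp only [Submodule.coe_add, hadd]
  have hsmU : ∀ U : Submodule ℂ W, ∀ (c : ℂ) (x y : U), s ((c • x : U) : W) y = c * s (x : W) y :=
    fun U c x y => by simp only [Submodule.coe_smul, hsmul]
  -- STEP 1: the good (odd) ranks
  have key : ∀ B' ∈ 𝔊, Θ * B' = B' → B' * Θ = -B' →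
      (Module.finrank ℂ (LinearMap.range B') = 1 ∨ Module.finrank ℂ (LinearMap.range B') = 3 ∨ Module.finrank ℂ (LinearMap.range B') = 5 ∨ Module.finrank ℂ (LinearMap.range B') = 7 ∨ Module.finrank ℂ (LinearMap.range B') = 9 ∨ Module.finrank ℂ (LinearMap.range B') = 11 ∨ Module.finrank ℂ (LinearMap.range B') = 13 ∨ Module.finrank ℂ (LinearMap.range B') = 15) → 𝔊 = ⊤ := by
    intro B' hB' hΘB' hB'Θ hr
    refine UnitaryDoubleLevi.eq_top_of_raise_of_core hbr hirr hΘ hΘΘ hP hQ hadd hsymm hPQ hdefP hdefQ hadj hB' hΘB' hB'Θ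
      (by omega) (by omega) (by omega)
      fun U 𝔩 ι P' Q' hbr𝔩 hirr𝔩 hι hιι hP' hQ' hfinP' hfinQ' hP'Q' hdefP' hdefQ' hadj𝔩 => ?_
    rw [hQ16] at hfinQ'
    rcases hr with h | h | h | h | h | h | h | h <;> rw [h] at hfinP' hfinQ'
    · -- `(1 | 15)`: the `(m, 1)` core for `−ι`
      exact UnitaryThreeCoprime.eq_top_of_finrank_eq_one hbr𝔩 hirr𝔩 (Submodule.neg_mem _ hι)
        ((neg_mul_neg ι ι).trans hιι) (P := Q') (Q := P') (fun x => by rw [hQ', LinearMap.neg_apply, neg_eq_iff_eq_neg])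
        (fun x => by rw [hP', LinearMap.neg_apply, neg_inj]) (by omega) hfinP'
    · -- `(3 | 13)`
      exact UnitaryThreeCoprime.eq_top hbr𝔩 hirr𝔩 hι hιι hP' hQ' hfinP' (by omega) (s := fun x y : U => s (x : W) y)
        (hsU U) (fun x y => hsymm x y) hP'Q' hdefP' hdefQ' hadj𝔩
    · -- `(5 | 11)`
      exact UnitaryFive.eq_top_of_smul hbr𝔩 hirr𝔩 hι hιι hP' hQ' hfinP' (by omega) (s := fun x y : U => s (x : W) y)
        (hsU U) (hsmU U) (fun x y => hsymm x y) hP'Q' hdefP' hdefQ' hadj𝔩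
    · -- `(7 | 9)`
      exact UnitarySeven.eq_top_of_smul hbr𝔩 hirr𝔩 hι hιι hP' hQ' hfinP' (by omega) (s := fun x y : U => s (x : W) y)
        (hsU U) (hsmU U) (fun x y => hsymm x y) hP'Q' hdefP' hdefQ' hadj𝔩
    · -- `(9 | 7)`
      exact UnitarySeven.eq_top_of_smul' hbr𝔩 hirr𝔩 hι hιι hP' hQ' (by omega) (by omega)
        (s := fun x y : U => s (x : W) y) (hsU U) (hsmU U) (fun x y => hsymm x y) hP'Q' hdefP' hdefQ' hadj𝔩
    · -- `(11 | 5)`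
      exact UnitaryFive.eq_top_of_smul' hbr𝔩 hirr𝔩 hι hιι hP' hQ' (by omega) (by omega)
        (s := fun x y : U => s (x : W) y) (hsU U) (hsmU U) (fun x y => hsymm x y) hP'Q' hdefP' hdefQ' hadj𝔩
    · -- `(13 | 3)`
      exact UnitaryThreeCoprime.eq_top' hbr𝔩 hirr𝔩 hι hιι hP' hQ' (by omega) (by omega)
        (s := fun x y : U => s (x : W) y) (hsU U) (fun x y => hsymm x y) hP'Q' hdefP' hdefQ' hadj𝔩
    · -- `(15 | 1)`
      exact UnitaryThreeCoprime.eq_top_of_finrank_eq_one hbr𝔩 hirr𝔩 hι hιι hP' hQ' (by omega) (by omega)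
  -- STEP 2: otherwise every raising operator has even rank
  by_contra hne
  have hbad : ∀ B' ∈ 𝔊, Θ * B' = B' → B' * Θ = -B' →
      Module.finrank ℂ (LinearMap.range B') = 0 ∨ Module.finrank ℂ (LinearMap.range B') = 2 ∨ Module.finrank ℂ (LinearMap.range B') = 4 ∨ Module.finrank ℂ (LinearMap.range B') = 6 ∨ Module.finrank ℂ (LinearMap.range B') = 8 ∨ Module.finrank ℂ (LinearMap.range B') = 10 ∨ Module.finrank ℂ (LinearMap.range B') = 12 ∨ Module.finrank ℂ (LinearMap.range B') = 14 := by
    intro B' hB' hΘB' hB'Θ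
    have h15 := hle15 B' hΘB'
    have hk : ¬ (Module.finrank ℂ (LinearMap.range B') = 1 ∨ Module.finrank ℂ (LinearMap.range B') = 3 ∨ Module.finrank ℂ (LinearMap.range B') = 5 ∨ Module.finrank ℂ (LinearMap.range B') = 7 ∨ Module.finrank ℂ (LinearMap.range B') = 9 ∨ Module.finrank ℂ (LinearMap.range B') = 11 ∨ Module.finrank ℂ (LinearMap.range B') = 13 ∨ Module.finrank ℂ (LinearMap.range B') = 15) :=
      fun h => hne (key B' hB' hΘB' hB'Θ h)
    omega
  -- STEP 3: no `2`; then the maximal rank is `0`, `4`, `6`, `8` or `14`, each impossible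
  have hno2 : ∀ B ∈ 𝔊, Θ * B = B → B * Θ = -B → Module.finrank ℂ (LinearMap.range B) ≠ 2 :=
    fun B hB hΘB hBΘ h2 => UnitaryFifteenSixteen.no_rank_two hbr hirr hΘ hΘΘ hP hQ hP15 hQ16 hadd hsymm hPQ hdefP hdefQ
      hadj hbad hB hΘB hBΘ h2
  have hbad₂ : ∀ B' ∈ 𝔊, Θ * B' = B' → B' * Θ = -B' →
      Module.finrank ℂ (LinearMap.range B') = 0 ∨ Module.finrank ℂ (LinearMap.range B') = 4 ∨ Module.finrank ℂ (LinearMap.range B') = 6 ∨ Module.finrank ℂ (LinearMap.range B') = 8 ∨ Module.finrank ℂ (LinearMap.range B') = 10 ∨ Module.finrank ℂ (LinearMap.range B') = 12 ∨ Module.finrank ℂ (LinearMap.range B') = 14 := by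
    intro B' hB' hΘB' hB'Θ
    have h2 := hno2 B' hB' hΘB' hB'Θ
    rcases hbad B' hB' hΘB' hB'Θ with h | h | h | h | h | h | h | h <;> omega
  have hr0 : Module.finrank ℂ (LinearMap.range B) ≠ 0 := by
    intro h0
    obtain ⟨B₂, hB₂, hΘB₂, hB₂Θ, hr2⟩ :=
      UnitaryThreeCoprime.exists_raise_rank_ge_two hbr hirr hΘ hΘΘ hP hQ (by omega) (by omega)
    have := hmax B₂ hB₂ hΘB₂ hB₂Θ
    omega
  rcases hbad₂ B hB hΘB hBΘ with h | h | h | h | h | h | h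
  · exact hr0 h
  · exact UnitaryFifteenSixteen.no_maxRank_four hbr hirr hΘ hΘΘ hP hQ hP15 hadd hsymm hPQ hdefP hdefQ hadj hbad₂ hB hΘB
      hBΘ hmax h
  · exact UnitaryFifteenSixteen.no_maxRank_six hbr hirr hΘ hΘΘ hP hQ hP15 hQ16 hadd hsymm hPQ hdefP hdefQ hadj hbad₂ hB
      hΘB hBΘ hmax h
  · exact UnitaryFifteenSixteen.no_maxRank_eight hbr hirr hΘ hΘΘ hP hQ hP15 hadd hsmul hsymm hPQ hdefP hdefQ hadj hbad₂
      hB hΘB hBΘ hmax h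
  · exact h10 h
  · exact h12 h
  · exact UnitaryFifteenSixteen.no_rank_fourteen hbr hirr hΘ hΘΘ hP hQ hP15 hQ16 hadd hsymm hPQ hdefP hdefQ hadj hbad₂ hB
      hΘB hBΘ h

/-- **The residual configuration of the `(15 | 16)` cell.** Under the hypotheses of `eq_top_of_smul_of_maxRank`, a
PROPER `𝔊` has a raising operator `B` of maximal rank with `rk B = 10` or `rk B = 12`, and every raising operator
has rank in `{0, 4, 6, 8, 10, 12}`. [cite: Ribet1983, Thm. 3] [cite: Gordon1997, Thm. 6.3 (3)]
[cite: Deligne1982HodgeCycles, I §3 Prop. 3.4, 3.6] -/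
theorem UnitaryFifteenSixteen.exists_maxRank_of_ne_top [FiniteDimensional ℂ W] {𝔊 : Submodule ℂ (Module.End ℂ W)}
    (hbr : ∀ Y ∈ 𝔊, ∀ Z ∈ 𝔊, Y * Z - Z * Y ∈ 𝔊)
    (hirr : ∀ U : Submodule ℂ W, (∀ A ∈ 𝔊, ∀ u ∈ U, A u ∈ U) → U = ⊥ ∨ U = ⊤)
    {Θ : Module.End ℂ W} (hΘ : Θ ∈ 𝔊) (hΘΘ : Θ * Θ = 1)
    {P Q : Submodule ℂ W} (hP : ∀ x, x ∈ P ↔ Θ x = x) (hQ : ∀ x, x ∈ Q ↔ Θ x = -x)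
    (hP15 : Module.finrank ℂ P = 15) (hQ16 : Module.finrank ℂ Q = 16)
    {s : W → W → ℂ} (hadd : ∀ x y z, s (x + y) z = s x z + s y z)
    (hsmul : ∀ (c : ℂ) (x y : W), s (c • x) y = c * s x y) (hsymm : ∀ x y, s y x = starRingEnd ℂ (s x y))
    (hPQ : ∀ p ∈ P, ∀ q ∈ Q, s p q = 0) (hdefP : ∀ p ∈ P, s p p = 0 → p = 0) (hdefQ : ∀ q ∈ Q, s q q = 0 → q = 0)
    (hadj : ∀ X ∈ 𝔊, ∃ Y ∈ 𝔊, ∀ x y, s (X x) y = s x (Y y)) (hne : 𝔊 ≠ ⊤) :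
    (∃ B ∈ 𝔊, Θ * B = B ∧ B * Θ = -B ∧
      (∀ B' ∈ 𝔊, Θ * B' = B' → B' * Θ = -B' →
        Module.finrank ℂ (LinearMap.range B') ≤ Module.finrank ℂ (LinearMap.range B)) ∧
      (Module.finrank ℂ (LinearMap.range B) = 10 ∨ Module.finrank ℂ (LinearMap.range B) = 12)) ∧
    ∀ B' ∈ 𝔊, Θ * B' = B' → B' * Θ = -B' →
      Module.finrank ℂ (LinearMap.range B') = 0 ∨ Module.finrank ℂ (LinearMap.range B') = 4 ∨ Module.finrank ℂ (LinearMap.range B') = 6 ∨ Module.finrank ℂ (LinearMap.range B') = 8 ∨ Module.finrank ℂ (LinearMap.range B') = 10 ∨ Module.finrank ℂ (LinearMap.range B') = 12 := by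
  classical
  obtain ⟨B, hB, hΘB, hBΘ, hmax⟩ := UnitaryRaisingSpace.exists_maxRank_raise 𝔊 Θ
  have h1012 : Module.finrank ℂ (LinearMap.range B) = 10 ∨ Module.finrank ℂ (LinearMap.range B) = 12 := by
    by_contra h
    exact hne (UnitaryFifteenSixteen.eq_top_of_smul_of_maxRank hbr hirr hΘ hΘΘ hP hQ hP15 hQ16 hadd hsmul hsymm hPQ
      hdefP hdefQ hadj hB hΘB hBΘ hmax (fun h' => h (Or.inl h')) (fun h' => h (Or.inr h')))
  refine ⟨⟨B, hB, hΘB, hBΘ, hmax, h1012⟩, fun B' hB' hΘB' hB'Θ => ?_⟩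
  have hraiseval : ∀ Z : Module.End ℂ W, Θ * Z = Z → ∀ w, Z w ∈ P := fun Z hΘZ w =>
    (hP _).2 (by rw [← Module.End.mul_apply, hΘZ])
  have hle15 : ∀ B' : Module.End ℂ W, Θ * B' = B' → Module.finrank ℂ (LinearMap.range B') ≤ 15 := fun B' h => by
    rw [← hP15]
    exact Submodule.finrank_mono (by rintro _ ⟨w, rfl⟩; exact hraiseval B' h w)
  have hsU : ∀ U : Submodule ℂ W, ∀ x y z : U, s ((x + y : U) : W) z = s (x : W) z + s (y : W) z :=
    fun U x y z => by simp only [Submodule.coe_add, hadd]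
  have hsmU : ∀ U : Submodule ℂ W, ∀ (c : ℂ) (x y : U), s ((c • x : U) : W) y = c * s (x : W) y :=
    fun U c x y => by simp only [Submodule.coe_smul, hsmul]
  -- the odd ranks are good (as in `eq_top_of_smul_of_maxRank`)
  have key : ∀ B' ∈ 𝔊, Θ * B' = B' → B' * Θ = -B' →
      (Module.finrank ℂ (LinearMap.range B') = 1 ∨ Module.finrank ℂ (LinearMap.range B') = 3 ∨ Module.finrank ℂ (LinearMap.range B') = 5 ∨ Module.finrank ℂ (LinearMap.range B') = 7 ∨ Module.finrank ℂ (LinearMap.range B') = 9 ∨ Module.finrank ℂ (LinearMap.range B') = 11 ∨ Module.finrank ℂ (LinearMap.range B') = 13 ∨ Module.finrank ℂ (LinearMap.range B') = 15) → 𝔊 = ⊤ := by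
    intro B' hB' hΘB' hB'Θ hr
    refine UnitaryDoubleLevi.eq_top_of_raise_of_core hbr hirr hΘ hΘΘ hP hQ hadd hsymm hPQ hdefP hdefQ hadj hB' hΘB' hB'Θ
      (by omega) (by omega) (by omega)
      fun U 𝔩 ι P' Q' hbr𝔩 hirr𝔩 hι hιι hP' hQ' hfinP' hfinQ' hP'Q' hdefP' hdefQ' hadj𝔩 => ?_
    rw [hQ16] at hfinQ'
    rcases hr with h | h | h | h | h | h | h | h <;> rw [h] at hfinP' hfinQ'
    · exact UnitaryThreeCoprime.eq_top_of_finrank_eq_one hbr𝔩 hirr𝔩 (Submodule.neg_mem _ hι)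
        ((neg_mul_neg ι ι).trans hιι) (P := Q') (Q := P') (fun x => by rw [hQ', LinearMap.neg_apply, neg_eq_iff_eq_neg])
        (fun x => by rw [hP', LinearMap.neg_apply, neg_inj]) (by omega) hfinP'
    · exact UnitaryThreeCoprime.eq_top hbr𝔩 hirr𝔩 hι hιι hP' hQ' hfinP' (by omega) (s := fun x y : U => s (x : W) y)
        (hsU U) (fun x y => hsymm x y) hP'Q' hdefP' hdefQ' hadj𝔩
    · exact UnitaryFive.eq_top_of_smul hbr𝔩 hirr𝔩 hι hιι hP' hQ' hfinP' (by omega) (s := fun x y : U => s (x : W) y)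
        (hsU U) (hsmU U) (fun x y => hsymm x y) hP'Q' hdefP' hdefQ' hadj𝔩
    · exact UnitarySeven.eq_top_of_smul hbr𝔩 hirr𝔩 hι hιι hP' hQ' hfinP' (by omega) (s := fun x y : U => s (x : W) y)
        (hsU U) (hsmU U) (fun x y => hsymm x y) hP'Q' hdefP' hdefQ' hadj𝔩
    · exact UnitarySeven.eq_top_of_smul' hbr𝔩 hirr𝔩 hι hιι hP' hQ' (by omega) (by omega)
        (s := fun x y : U => s (x : W) y) (hsU U) (hsmU U) (fun x y => hsymm x y) hP'Q' hdefP' hdefQ' hadj𝔩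
    · exact UnitaryFive.eq_top_of_smul' hbr𝔩 hirr𝔩 hι hιι hP' hQ' (by omega) (by omega)
        (s := fun x y : U => s (x : W) y) (hsU U) (hsmU U) (fun x y => hsymm x y) hP'Q' hdefP' hdefQ' hadj𝔩
    · exact UnitaryThreeCoprime.eq_top' hbr𝔩 hirr𝔩 hι hιι hP' hQ' (by omega) (by omega)
        (s := fun x y : U => s (x : W) y) (hsU U) (fun x y => hsymm x y) hP'Q' hdefP' hdefQ' hadj𝔩
    · exact UnitaryThreeCoprime.eq_top_of_finrank_eq_one hbr𝔩 hirr𝔩 hι hιι hP' hQ' (by omega) (by omega)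
  have hbad : ∀ B' ∈ 𝔊, Θ * B' = B' → B' * Θ = -B' →
      Module.finrank ℂ (LinearMap.range B') = 0 ∨ Module.finrank ℂ (LinearMap.range B') = 2 ∨ Module.finrank ℂ (LinearMap.range B') = 4 ∨ Module.finrank ℂ (LinearMap.range B') = 6 ∨ Module.finrank ℂ (LinearMap.range B') = 8 ∨ Module.finrank ℂ (LinearMap.range B') = 10 ∨ Module.finrank ℂ (LinearMap.range B') = 12 ∨ Module.finrank ℂ (LinearMap.range B') = 14 := by
    intro B' hB' hΘB' hB'Θ
    have h15 := hle15 B' hΘB'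
    have hk : ¬ (Module.finrank ℂ (LinearMap.range B') = 1 ∨ Module.finrank ℂ (LinearMap.range B') = 3 ∨ Module.finrank ℂ (LinearMap.range B') = 5 ∨ Module.finrank ℂ (LinearMap.range B') = 7 ∨ Module.finrank ℂ (LinearMap.range B') = 9 ∨ Module.finrank ℂ (LinearMap.range B') = 11 ∨ Module.finrank ℂ (LinearMap.range B') = 13 ∨ Module.finrank ℂ (LinearMap.range B') = 15) :=
      fun h => hne (key B' hB' hΘB' hB'Θ h)
    omega
  have h2 : Module.finrank ℂ (LinearMap.range B') ≠ 2 := fun h2 =>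
    UnitaryFifteenSixteen.no_rank_two hbr hirr hΘ hΘΘ hP hQ hP15 hQ16 hadd hsymm hPQ hdefP hdefQ hadj hbad hB' hΘB' hB'Θ h2
  have hle := hmax B' hB' hΘB' hB'Θ
  rcases hbad B' hB' hΘB' hB'Θ with h | h | h | h | h | h | h | h <;> omega

end HodgeStructure

end Literature.AlgebraicGeometry.Motives

end
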